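/-
Q_C RE-TYPED (rh-split cell, K-lane; seat rh-split-ref g13 = refuter acting as functional referee, 2026-08-28;
lead RULING #512).  RE-TYPING of the «OPEN question» `IntegerWindowTheft` typed (statement only,
«neither asserted nor denied») in `Theorems/Splittings/PrimeWindowBlindnessClass.lean` l.181 (rh-idea-4 g3 / typer-3 g5;
B27/B33 «PRIME-WINDOW BLINDNESS», clause 3 «exactness × integrality», K7′).  FINDING OF RECORD: that decl is FALSE AS
TYPED for every window `U` and width `σ*` — its multiplicity clause `∀ ρ : ℂ, (n ρ : ℤ) ≤ riemannZetaZeroOrder ρ` is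
tested at the POLE `ρ = 1`, where `riemannZetaZeroOrder 1 = -1` (`riemannZetaZeroOrder_one_holds`) while `0 ≤ n 1`
(kernel record `not_integerWindowTheft_as_typed` in the companion module `Theorems/Splittings/Negative/IntegerWindowTheftAsTyped.lean`;
class refuted-MISSTATED: the prose means «a sub-multiset `n ≤ m` of the TRUE zeros»).
REPAIR: `IntegerWindowTheft'` (C′) = the old decl VERBATIM with that one clause relativised to the nontrivial zeros, and
`IntegerWindowTheftOnLine` (C″) = C′ + «steal only critical-line zeros».  Every K-lane statement about Q_C refers to C′/C″
henceforth; the old decl is left in place (landed declarations are never edited) and occurs in no theorem.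
`--supports stmt-RiemannHypothesis-21693`; no `instance`, no notation, nothing `private`;
ζ enters only through the tree's zero set / multiplicity API; std axioms.  Nothing here bears on the truth of RH.
-/
import Summits.RiemannHypothesis.RiemannHypothesis.Theorems.Splittings.PrimeWindowBlindnessClass
import Literature.NumberTheory.LFunctions.ZetaZerosProofs
import Literature.NumberTheory.LFunctions.ZetaZerosReflection
import HarnessLib

/-!
# Q_C re-typed: the repaired questions C′ / C″ behind `IntegerWindowTheft`

1. `IntegerWindowTheft U σ*` is false for ALL `U σ*` as typed (pole at `s = 1`; kernel record
   `not_integerWindowTheft_as_typed`, companion module `Negative/IntegerWindowTheftAsTyped.lean`).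
2. `IntegerWindowTheft'` (C′): clause 6 relativised to `ZetaZeros.riemannZetaNontrivialZeros` (equivalently `ρ ≠ 1 →`,
   since clause 7 zeroes `n` off the nontrivial zeros).  Junk checks BY DESIGN: C′ is false for `σ* ≤ 0`
   (`integerWindowTheft'_false_of_width_nonpos`, empty abscissa band) and true for `U ≤ 0 < σ*`
   (`integerWindowTheft'_of_window_nonpos`, theft `n = 0`): Q_C′ is meaningful exactly on `0 < U`, `0 < σ*`.
3. THE NO DIRECTION OF C′ IS NOT RH-FREE (theory desk rider 25.33 (B), kernel form, double-zero half):
   `integerWindowTheft'_of_offline_double_zero` — a hypothetical OFF-LINE zero `ρ` of multiplicity `≥ 2` with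
   `1/2 < Re ρ < min (1, 1/2 + σ*)`, `Im ρ > 0` makes C′ TRUE at EVERY window: the configuration with the single index
   `κ₁ = κ₂ = ρ - 1/2`, `m = 1`, steals itself (`n = 2` on `{ρ, 1-ρ, ρ̄, 1-ρ̄}`), the window identity being the term-by-term
   identity `quadTerm_eq_sum_four` (no dependence on `U`).  Contrapositive `offline_simple_of_not_integerWindowTheft'`:
   `¬ C′(U, σ*)` at ONE window implies that every off-line zero of that band is SIMPLE — hypothesis-side content about
   off-line zeros.  (The common-abscissa half — two distinct off-line zeros `ρ ≠ ρ′`, `Re ρ = Re ρ′`, also steal themselves,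
   `κ₁ = ρ - 1/2`, `κ₂ = ρ′ - 1/2`, `n = 1` on the eight symmetric points — is the same identity with two quadruples and is
   recorded here in prose only.)  The YES direction (a K7′ removal + balanced-sliding construction) is untouched: RH-free.
4. `IntegerWindowTheftOnLine` (C″) = C′ + `∀ ρ, n ρ ≠ 0 → Re ρ = 1/2` (steal only critical-line zeros): the RH-free
   residual form of Q_C; `integerWindowTheftOnLine_imp` (C″ → C′) and its junk checks.
-/

noncomputable section

set_option linter.dupNamespace false

open Complex Set
open scoped ComplexConjugate Real

namespace Summit.RiemannHypothesis.RiemannHypothesis.Theorems.Splittings.ScrewLatticeTower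

open Summit.RiemannHypothesis.RiemannHypothesis.Theorems.Splittings.ScrewLatticeWolff
open Literature.NumberTheory.LFunctions

/-! ## 1. C′ and C″: the repaired questions (statements only; neither asserted nor denied for `0 < U`, `0 < σ*`) -/

/-- **Q_C′ — integer window theft, re-typed (OPEN for `0 < U`, `0 < σ*`; neither asserted nor denied here).**
`IntegerWindowTheft` verbatim except that the theft multiplicity is bounded by the true multiplicity ON THE NONTRIVIAL
ZEROS only (`∀ ρ ∈ ZetaZeros.riemannZetaNontrivialZeros, n ρ ≤ m(ρ)`): a NON-EMPTY capped (`0 < Re κ < σ*`) configuration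
of UNIT off-line quadruples, locally finite in height with `Σ 1/γ² < ∞`, whose exact window trace on `[-U, U]` equals the
trace of a sub-multiset `n ≤ m` of the true nontrivial zeros of `ζ`.  Its NO direction at a single window is NOT RH-free
(`offline_simple_of_not_integerWindowTheft'`); see `IntegerWindowTheftOnLine` for the RH-free form. -/
def IntegerWindowTheft' (U σs : ℝ) : Prop :=
  ∃ (Z : Config) (n : ℂ → ℕ),
    Nonempty Z.ι ∧
    (∀ i, Z.m₁ i = 1 ∧ Z.m₂ i = 1) ∧
    (∀ i, 0 < (Z.κ₁ i).re ∧ (Z.κ₁ i).re < σs ∧ (Z.κ₂ i).re = (Z.κ₁ i).re) ∧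
    (∀ T : ℝ, {i | (Z.κ₁ i).im ≤ T}.Finite ∧ {i | (Z.κ₂ i).im ≤ T}.Finite) ∧
    Summable (fun i ↦ 1 / (Z.κ₁ i).im ^ 2 + 1 / (Z.κ₂ i).im ^ 2) ∧
    (∀ ρ ∈ ZetaZeros.riemannZetaNontrivialZeros, (n ρ : ℤ) ≤ riemannZetaZeroOrder ρ) ∧
    (∀ ρ : ℂ, ρ ∉ ZetaZeros.riemannZetaNontrivialZeros → n ρ = 0) ∧
    ∀ t : ℝ, |t| ≤ U →
      HasSum (fun ρ : ZetaZeros.riemannZetaNontrivialZeros ↦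
          (n (ρ : ℂ) : ℂ) * ((Complex.cosh (((ρ : ℂ) - 1 / 2) * t) - 1) / ((ρ : ℂ) - 1 / 2) ^ 2))
        (Z.psi t : ℂ)

/-- **Q_C″ — on-line-restricted integer window theft (OPEN for `0 < U`, `0 < σ*`; neither asserted nor denied here).**
C′ with theft permitted only from CRITICAL-LINE zeros (`n ρ ≠ 0 → Re ρ = 1/2`): the RH-free residual form of the
«exactness × integrality» question of B33 clause 3 (its NO direction is the «t → 0 germ for towers» question). -/
def IntegerWindowTheftOnLine (U σs : ℝ) : Prop :=
  ∃ (Z : Config) (n : ℂ → ℕ),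
    Nonempty Z.ι ∧
    (∀ i, Z.m₁ i = 1 ∧ Z.m₂ i = 1) ∧
    (∀ i, 0 < (Z.κ₁ i).re ∧ (Z.κ₁ i).re < σs ∧ (Z.κ₂ i).re = (Z.κ₁ i).re) ∧
    (∀ T : ℝ, {i | (Z.κ₁ i).im ≤ T}.Finite ∧ {i | (Z.κ₂ i).im ≤ T}.Finite) ∧
    Summable (fun i ↦ 1 / (Z.κ₁ i).im ^ 2 + 1 / (Z.κ₂ i).im ^ 2) ∧
    (∀ ρ ∈ ZetaZeros.riemannZetaNontrivialZeros, (n ρ : ℤ) ≤ riemannZetaZeroOrder ρ) ∧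
    (∀ ρ : ℂ, ρ ∉ ZetaZeros.riemannZetaNontrivialZeros → n ρ = 0) ∧
    (∀ ρ : ℂ, n ρ ≠ 0 → ρ.re = 1 / 2) ∧
    ∀ t : ℝ, |t| ≤ U →
      HasSum (fun ρ : ZetaZeros.riemannZetaNontrivialZeros ↦
          (n (ρ : ℂ) : ℂ) * ((Complex.cosh (((ρ : ℂ) - 1 / 2) * t) - 1) / ((ρ : ℂ) - 1 / 2) ^ 2))
        (Z.psi t : ℂ)

/-- C″ implies C′ (drop the on-line restriction). -/
theorem integerWindowTheftOnLine_imp {U σs : ℝ} (h : IntegerWindowTheftOnLine U σs) : IntegerWindowTheft' U σs := by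
  obtain ⟨Z, n, h1, h2, h3, h4, h5, h6, h7, -, h9⟩ := h
  exact ⟨Z, n, h1, h2, h3, h4, h5, h6, h7, h9⟩

/-! ## 2. Junk-parameter checks of C′ / C″ (by design: the questions live on `0 < U`, `0 < σ*`) -/

/-- C′ is false for a non-positive width (the abscissa band `0 < Re κ < σ*` is empty). -/
theorem integerWindowTheft'_false_of_width_nonpos {U σs : ℝ} (h : σs ≤ 0) : ¬ IntegerWindowTheft' U σs := by
  rintro ⟨Z, n, ⟨i⟩, -, hre, -⟩
  have h1 := (hre i).1
  have h2 := (hre i).2.1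
  linarith

/-- C″ is false for a non-positive width. -/
theorem integerWindowTheftOnLine_false_of_width_nonpos {U σs : ℝ} (h : σs ≤ 0) : ¬ IntegerWindowTheftOnLine U σs :=
  fun h' ↦ integerWindowTheft'_false_of_width_nonpos h (integerWindowTheftOnLine_imp h')

/-- C″ (hence C′) is true for a non-positive window: one quadruple `κ = σ*/2 + i`, theft `n = 0`; the window is `⊆ {0}`
and `Ψ_Z(0) = 0` (`modelPsi_zero`). -/
theorem integerWindowTheftOnLine_of_window_nonpos {U σs : ℝ} (hU : U ≤ 0) (hσ : 0 < σs) :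
    IntegerWindowTheftOnLine U σs := by
  refine ⟨⟨Unit, fun _ ↦ 1, fun _ ↦ 1, fun _ ↦ ((σs / 2 : ℝ) : ℂ) + Complex.I, fun _ ↦ ((σs / 2 : ℝ) : ℂ) + Complex.I⟩,
    fun _ ↦ 0, ⟨()⟩, fun _ ↦ ⟨rfl, rfl⟩, fun _ ↦ ⟨?_, ?_, rfl⟩, fun _ ↦ ⟨Set.toFinite _, Set.toFinite _⟩,
    (hasSum_fintype _).summable, ?_, fun _ _ ↦ rfl, fun _ h ↦ (h rfl).elim, ?_⟩
  · simp; linarith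
  · simp; linarith
  · intro ρ hρ
    have h1 : ρ.re < 1 := (mem_riemannZetaNontrivialZeros_iff_holds.1 hρ).2.2
    have hρ1 : ρ ≠ 1 := fun h ↦ by rw [h] at h1; simp at h1
    exact_mod_cast riemannZetaZeroOrder_nonneg hρ1
  · intro t ht
    have ht0 : t = 0 := by
      have : |t| ≤ 0 := le_trans ht hU
      exact abs_nonpos_iff.mp this
    subst ht0
    have hpsi : Config.psi ⟨Unit, fun _ ↦ 1, fun _ ↦ 1, fun _ ↦ ((σs / 2 : ℝ) : ℂ) + Complex.I,
        fun _ ↦ ((σs / 2 : ℝ) : ℂ) + Complex.I⟩ 0 = 0 := by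
      simp [Config.psi, modelPsi_zero]
    rw [hpsi]
    simp

/-- C′ is true for a non-positive window (from the C″ witness). -/
theorem integerWindowTheft'_of_window_nonpos {U σs : ℝ} (hU : U ≤ 0) (hσ : 0 < σs) : IntegerWindowTheft' U σs :=
  integerWindowTheftOnLine_imp (integerWindowTheftOnLine_of_window_nonpos hU hσ)

/-! ## 3. The NO direction of C′ is not RH-free: an off-line multiple zero steals itself -/

/-- A point of the open critical strip of multiplicity `≥ 2` is a nontrivial zero (`riemannZetaZeroOrder_pos_iff`,
`mem_riemannZetaNontrivialZeros_iff_holds`). -/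
theorem mem_nontrivialZeros_of_two_le_zeroOrder {s : ℂ} (h0 : 0 < s.re) (h1 : s.re < 1)
    (hm : 2 ≤ riemannZetaZeroOrder s) : s ∈ ZetaZeros.riemannZetaNontrivialZeros := by
  have hs1 : s ≠ 1 := fun h ↦ by rw [h] at h1; simp at h1
  have hz : riemannZeta s = 0 := (riemannZetaZeroOrder_pos_iff hs1).1 (by omega)
  exact mem_riemannZetaNontrivialZeros_iff_holds.2 ⟨hz, h0, h1⟩

/-- **An off-line multiple zero steals itself** (theory desk rider 25.33 (B), double-zero half): if `ζ` had a zero `ρ`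
of multiplicity `≥ 2` with `1/2 < Re ρ < 1/2 + σ*`, `Re ρ < 1`, `Im ρ > 0`, then C′ holds at EVERY window `U` — the
single-index configuration `κ₁ = κ₂ = ρ - 1/2`, `m = 1`, with theft `n = 2` on the quadruple `{ρ, 1-ρ, ρ̄, 1-ρ̄}` (nontrivial
zeros of multiplicity `m(ρ)` by `riemannZetaZeroOrder_conj_holds`, `riemannZetaZeroOrder_one_sub_holds`,
`riemannZetaZeroOrder_one_sub_conj`); the exact window identity is `quadTerm_eq_sum_four`, at every `t`. -/
theorem integerWindowTheft'_of_offline_double_zero {σs : ℝ} {ρ : ℂ}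
    (h₀ : 1 / 2 < ρ.re) (hσ : ρ.re < 1 / 2 + σs) (h₁ : ρ.re < 1) (hγ : 0 < ρ.im)
    (hm : 2 ≤ riemannZetaZeroOrder ρ) (U : ℝ) : IntegerWindowTheft' U σs := by
  classical
  have h0' : 0 < ρ.re := by linarith
  -- multiplicities of the quadruple
  have hmc : riemannZetaZeroOrder (conj ρ) = riemannZetaZeroOrder ρ := riemannZetaZeroOrder_conj_holds ρ
  have hm1 : riemannZetaZeroOrder (1 - ρ) = riemannZetaZeroOrder ρ := riemannZetaZeroOrder_one_sub_holds h0' h₁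
  have hm1c : riemannZetaZeroOrder (1 - conj ρ) = riemannZetaZeroOrder ρ := riemannZetaZeroOrder_one_sub_conj h0' h₁
  -- the four points are nontrivial zeros
  have nzρ : ρ ∈ ZetaZeros.riemannZetaNontrivialZeros := mem_nontrivialZeros_of_two_le_zeroOrder h0' h₁ hm
  have nz1ρ : 1 - ρ ∈ ZetaZeros.riemannZetaNontrivialZeros :=
    mem_nontrivialZeros_of_two_le_zeroOrder (by simp; linarith) (by simp; linarith) (by rw [hm1]; exact hm)
  have nzc : conj ρ ∈ ZetaZeros.riemannZetaNontrivialZeros :=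
    mem_nontrivialZeros_of_two_le_zeroOrder (by simp; linarith) (by simp; linarith) (by rw [hmc]; exact hm)
  have nz1c : 1 - conj ρ ∈ ZetaZeros.riemannZetaNontrivialZeros :=
    mem_nontrivialZeros_of_two_le_zeroOrder (by simp; linarith) (by simp; linarith) (by rw [hm1c]; exact hm)
  -- the four points are distinct
  have ne12 : ρ ≠ 1 - ρ := fun h ↦ by
    have := congrArg Complex.re h
    simp only [Complex.sub_re, Complex.one_re] at this; linarith
  have ne13 : ρ ≠ conj ρ := fun h ↦ by
    have := congrArg Complex.im h
    simp only [Complex.conj_im] at this; linarith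
  have ne14 : ρ ≠ 1 - conj ρ := fun h ↦ by
    have := congrArg Complex.re h
    simp only [Complex.sub_re, Complex.one_re, Complex.conj_re] at this; linarith
  have ne23 : 1 - ρ ≠ conj ρ := fun h ↦ by
    have := congrArg Complex.re h
    simp only [Complex.sub_re, Complex.one_re, Complex.conj_re] at this; linarith
  have ne24 : 1 - ρ ≠ 1 - conj ρ := fun h ↦ by
    have := congrArg Complex.im h
    simp only [Complex.sub_im, Complex.one_im, Complex.conj_im] at this; linarith
  have ne34 : conj ρ ≠ 1 - conj ρ := fun h ↦ by
    have := congrArg Complex.re h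
    simp only [Complex.sub_re, Complex.one_re, Complex.conj_re] at this; linarith
  -- the theft support
  set S : Finset ℂ := {ρ, 1 - ρ, conj ρ, 1 - conj ρ} with hS
  have memS : ∀ s : ℂ, s ∈ S ↔ s = ρ ∨ s = 1 - ρ ∨ s = conj ρ ∨ s = 1 - conj ρ := by
    intro s; simp [hS]
  have hSsub : ∀ s ∈ S, s ∈ ZetaZeros.riemannZetaNontrivialZeros := by
    intro s hs
    rcases (memS s).1 hs with rfl | rfl | rfl | rfl
    · exact nzρ
    · exact nz1ρ
    · exact nzc
    · exact nz1c
  refine ⟨⟨Unit, fun _ ↦ 1, fun _ ↦ 1, fun _ ↦ ρ - 1 / 2, fun _ ↦ ρ - 1 / 2⟩,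
    fun s ↦ if s ∈ S then 2 else 0, ⟨()⟩, fun _ ↦ ⟨rfl, rfl⟩, fun _ ↦ ⟨?_, ?_, rfl⟩,
    fun _ ↦ ⟨Set.toFinite _, Set.toFinite _⟩, (hasSum_fintype _).summable, ?_, ?_, ?_⟩
  · simp; linarith
  · simp; linarith
  · -- clause 6′: `n ≤ m` on the nontrivial zeros
    intro s hs
    by_cases hmem : s ∈ S
    · beta_reduce
      rw [if_pos hmem]
      push_cast
      rcases (memS s).1 hmem with rfl | rfl | rfl | rfl
      · exact hm
      · rw [hm1]; exact hm
      · rw [hmc]; exact hm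
      · rw [hm1c]; exact hm
    · beta_reduce
      rw [if_neg hmem]
      push_cast
      have h1 : s.re < 1 := (mem_riemannZetaNontrivialZeros_iff_holds.1 hs).2.2
      have hs1 : s ≠ 1 := fun h ↦ by rw [h] at h1; simp at h1
      exact riemannZetaZeroOrder_nonneg hs1
  · -- clause 7: no theft off the nontrivial zeros
    intro s hs
    exact if_neg (fun hmem ↦ hs (hSsub s hmem))
  · -- clause 8: the exact window identity, at every `t` (the window `U` plays no role)
    intro t _ht
    set g : ℂ → ℂ := fun s ↦ ((if s ∈ S then 2 else 0 : ℕ) : ℂ) *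
      ((Complex.cosh ((s - 1 / 2) * t) - 1) / (s - 1 / 2) ^ 2) with hg
    have hsupp : Function.support g ⊆ ZetaZeros.riemannZetaNontrivialZeros := by
      intro s hs
      by_contra hnz
      apply hs
      simp only [hg]
      rw [if_neg (fun hmem ↦ hnz (hSsub s hmem))]
      simp
    refine (hasSum_subtype_iff_indicator (f := g)).2 ?_
    rw [Set.indicator_eq_self.2 hsupp]
    have hpsi : Config.psi ⟨Unit, fun _ ↦ 1, fun _ ↦ 1, fun _ ↦ ρ - 1 / 2, fun _ ↦ ρ - 1 / 2⟩ t =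
        quadTerm 1 (ρ - 1 / 2) t + quadTerm 1 (ρ - 1 / 2) t := by
      simp [Config.psi, modelPsi, tsum_fintype]
    have hA : ρ ∉ ({1 - ρ, conj ρ, 1 - conj ρ} : Finset ℂ) := by
      simp only [Finset.mem_insert, Finset.mem_singleton, not_or]; exact ⟨ne12, ne13, ne14⟩
    have hB : 1 - ρ ∉ ({conj ρ, 1 - conj ρ} : Finset ℂ) := by
      simp only [Finset.mem_insert, Finset.mem_singleton, not_or]; exact ⟨ne23, ne24⟩
    have hC : conj ρ ∉ ({1 - conj ρ} : Finset ℂ) := by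
      simp only [Finset.mem_singleton]; exact ne34
    have m1 : ρ ∈ S := (memS _).2 (Or.inl rfl)
    have m2 : 1 - ρ ∈ S := (memS _).2 (Or.inr (Or.inl rfl))
    have m3 : conj ρ ∈ S := (memS _).2 (Or.inr (Or.inr (Or.inl rfl)))
    have m4 : 1 - conj ρ ∈ S := (memS _).2 (Or.inr (Or.inr (Or.inr rfl)))
    have e1 : (1 : ℂ) - ρ - 1 / 2 = -(ρ - 1 / 2) := by ring
    have e2 : conj (ρ - 1 / 2) = conj ρ - 1 / 2 := by
      apply Complex.ext <;> simp
    have e3 : (1 : ℂ) - conj ρ - 1 / 2 = -conj (ρ - 1 / 2) := by rw [e2]; ring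
    have hval : ∑ b ∈ S, g b = ((Config.psi ⟨Unit, fun _ ↦ 1, fun _ ↦ 1, fun _ ↦ ρ - 1 / 2,
        fun _ ↦ ρ - 1 / 2⟩ t : ℝ) : ℂ) := by
      rw [hS, Finset.sum_insert hA, Finset.sum_insert hB, Finset.sum_insert hC, Finset.sum_singleton]
      simp only [hg]
      rw [if_pos m1, if_pos m2, if_pos m3, if_pos m4, hpsi, Complex.ofReal_add, quadTerm_eq_sum_four]
      rw [e3, e1, ← e2]
      push_cast
      ring
    rw [← hval]
    exact hasSum_sum_of_ne_finset_zero (fun b hb ↦ by simp only [hg]; rw [if_neg hb]; simp)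

/-- **Contrapositive (the rider's logical form).**  If C′ fails at some window `U`, then every OFF-LINE zero `ρ` of the band
`1/2 < Re ρ < min (1, 1/2 + σ*)`, `Im ρ > 0`, is SIMPLE: the NO direction of Q_C′ at a single window carries hypothesis-side
content about off-line zeros of `ζ` (it is not an RH-free statement). -/
theorem offline_simple_of_not_integerWindowTheft' {U σs : ℝ} (h : ¬ IntegerWindowTheft' U σs) {ρ : ℂ}
    (h₀ : 1 / 2 < ρ.re) (hσ : ρ.re < 1 / 2 + σs) (h₁ : ρ.re < 1) (hγ : 0 < ρ.im) :
    riemannZetaZeroOrder ρ ≤ 1 := by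
  by_contra hm
  exact h (integerWindowTheft'_of_offline_double_zero h₀ hσ h₁ hγ (by omega) U)

end Summit.RiemannHypothesis.RiemannHypothesis.Theorems.Splittings.ScrewLatticeTower

end
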